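import Mathlib.Data.Nat.Basic
import Mathlib.Order.Basic
import Mathlib.Tactic
import HarnessLib

-- provenance: harness21/H21/H21/Prelude/DiophValNum/KodairaSymbol.lean @ 5958c5e (interim HEAD d8f2665); M5 mechanical rewrite
/-!
# Kodaira symbols (trunk DiophValNum, item G22)

Pure combinatorics of the Kodaira–Néron classification of special fibres of minimal regular
models of elliptic curves over a discretely valued field: the symbols
`I_n (n ≥ 0), II, III, IV, I_n* (n ≥ 0), IV*, III*, II*`, together with the numerical data
attached to each symbol:

* `numComponents` : the number `m_v` of irreducible components of the geometric special fibre;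
* `componentGroupOrder` : the order of the geometric component group `Φ(k̄)`;
* `componentGroupExponent` : the exponent of the geometric component group `Φ(k̄)` (`2` vs `4` on `I_n*`);
* `tameConductorExponent` : the tame part `ε_v` of the conductor exponent
  (`0` for good, `1` for multiplicative, `2` for additive reduction);
* the predicates `IsGood`, `IsMultiplicative`, `IsAdditive`, `IsSemistable` with `Decidable`
  instances, and elementary sanity lemmas.

No geometry is done here; the link with Weierstrass models (Tate's algorithm, conductor) lives in
later files of the trunk. Mathlib (as pinned) has no declaration mentioning Kodaira symbols.

## References

* K. Kodaira, *On compact analytic surfaces II–III*, Ann. of Math. 77/78 (1963).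
* A. Néron, *Modèles minimaux des variétés abéliennes sur les corps locaux et globaux*,
  Publ. Math. IHÉS 21 (1964).
* J. H. Silverman, *Advanced Topics in the Arithmetic of Elliptic Curves*, Ch. IV, Table 4.1 and
  Theorem IV.8.2; §IV.10 (conductor).

## Design notes

`I 0` is the symbol `I₀` (good reduction) and `Istar 0` is `I₀*`. All functions are total on the
inductive type; `componentGroupOrder (I n) = max n 1` so that `I₀` has trivial component group.
The reduction-type predicates `IsGood`, `IsMultiplicative`, `IsAdditive`, `IsSemistable` take the
symbol as an explicit binder `(k : KodairaSymbol)` in their headers (rather than through the section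
`variable`), so that they read as what they are — decidable predicates `KodairaSymbol → Prop` with
bodies — and are not mistaken for closed `Prop`-valued named facts awaiting a proof.
-/

namespace Literature.NumberTheory.DiophantineGeometry

/-- The Kodaira symbol of the special fibre of the minimal regular model of an elliptic curve
over a discretely valued field: `I n` (`n ≥ 0`, with `I 0` = good reduction), `II`, `III`, `IV`,
`Istar n` = `I_n*` (`n ≥ 0`), `IVstar`, `IIIstar`, `IIstar`.
(Kodaira 1963; Néron 1964; Silverman ATAEC IV, Table 4.1.) [cite: Kodaira1963] -/
inductive KodairaSymbol
  /-- Type `I_n`, `n ≥ 0`; `I 0` is good reduction, `I n` (`n ≥ 1`) is multiplicative. -/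
  | I (n : ℕ)
  /-- Type `II` (cusp, additive). -/
  | II
  /-- Type `III` (additive). -/
  | III
  /-- Type `IV` (additive). -/
  | IV
  /-- Type `I_n*`, `n ≥ 0` (additive). -/
  | Istar (n : ℕ)
  /-- Type `IV*` (additive). -/
  | IVstar
  /-- Type `III*` (additive). -/
  | IIIstar
  /-- Type `II*` (additive). -/
  | IIstar
  deriving DecidableEq, Repr, Inhabited

namespace KodairaSymbol

variable (k : KodairaSymbol)

/-- The number `m_v` of irreducible components (over `k̄`, without multiplicity) of the special
fibre of the given Kodaira type: `I₀ ↦ 1`, `I_n ↦ n` (`n ≥ 1`), `II ↦ 1`, `III ↦ 2`, `IV ↦ 3`,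
`I_n* ↦ n + 5`, `IV* ↦ 7`, `III* ↦ 8`, `II* ↦ 9`. (Silverman ATAEC IV, Table 4.1.) [folklore] -/
def numComponents : KodairaSymbol → ℕ
  | I 0 => 1
  | I (n + 1) => n + 1
  | II => 1
  | III => 2
  | IV => 3
  | Istar n => n + 5
  | IVstar => 7
  | IIIstar => 8
  | IIstar => 9

/-- The order of the geometric component group `Φ(k̄) = 𝓔(k̄)/𝓔⁰(k̄)` of the Néron model:
`I_n ↦ n` (`I₀ ↦ 1`), `II ↦ 1`, `III ↦ 2`, `IV ↦ 3`, `I_n* ↦ 4`, `IV* ↦ 3`, `III* ↦ 2`,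
`II* ↦ 1`. In the split case this is the Tamagawa number `c_v`.
(Néron 1964; Silverman ATAEC IV, Table 4.1 and Cor. IV.9.2.) [cite: Neron1964] -/
def componentGroupOrder : KodairaSymbol → ℕ
  | I n => max n 1
  | II => 1
  | III => 2
  | IV => 3
  | Istar _ => 4
  | IVstar => 3
  | IIIstar => 2
  | IIstar => 1

/-- The tame part `ε_v` of the conductor exponent `f_v = ε_v + δ_v`: `0` for good reduction
(`I₀`), `1` for multiplicative reduction (`I_n`, `n ≥ 1`), `2` for additive reduction (all other
types). (Silverman ATAEC IV, §10, definition preceding Thm IV.10.2.) [folklore] -/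
def tameConductorExponent : KodairaSymbol → ℕ
  | I 0 => 0
  | I (_ + 1) => 1
  | _ => 2

/-- Good reduction: the Kodaira type is `I₀`. (Silverman ATAEC IV, Table 4.1.) [folklore] -/
def IsGood (k : KodairaSymbol) : Prop := k = .I 0

/-- Multiplicative (nodal) reduction: the Kodaira type is `I_n` with `n ≥ 1`.
(Silverman ATAEC IV, Table 4.1.) [folklore] -/
def IsMultiplicative (k : KodairaSymbol) : Prop := ∃ n, n ≠ 0 ∧ k = .I n

/-- Additive reduction: neither good nor multiplicative, i.e. one of the types
`II, III, IV, I_n*, IV*, III*, II*`. (Silverman ATAEC IV, Table 4.1.) [folklore] -/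
def IsAdditive (k : KodairaSymbol) : Prop := ¬ k.IsGood ∧ ¬ k.IsMultiplicative

/-- Semistable reduction: good or multiplicative, i.e. type `I_n` for some `n ≥ 0`.
(Silverman ATAEC IV, §10.) [folklore] -/
def IsSemistable (k : KodairaSymbol) : Prop := k.IsGood ∨ k.IsMultiplicative

/-- `I₀` has one component. (Silverman ATAEC IV, Table 4.1.) [folklore] -/
@[simp] lemma numComponents_I_zero : (I 0).numComponents = 1 := rfl

/-- `I_{n+1}` has `n + 1` components. (Silverman ATAEC IV, Table 4.1.) [folklore] -/
@[simp] lemma numComponents_I_succ (n : ℕ) : (I (n + 1)).numComponents = n + 1 := rfl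

/-- `I_n*` has `n + 5` components. (Silverman ATAEC IV, Table 4.1.) [folklore] -/
@[simp] lemma numComponents_Istar (n : ℕ) : (Istar n).numComponents = n + 5 := rfl

/-- `|Φ| = max n 1` for `I_n`. (Silverman ATAEC IV, Table 4.1.) [folklore] -/
@[simp] lemma componentGroupOrder_I (n : ℕ) : (I n).componentGroupOrder = max n 1 := rfl

/-- `|Φ| = 4` for `I_n*`. (Silverman ATAEC IV, Table 4.1.) [folklore] -/
@[simp] lemma componentGroupOrder_Istar (n : ℕ) : (Istar n).componentGroupOrder = 4 := rfl

/-- `ε = 0` for `I₀`. (Silverman ATAEC IV, §10.) [folklore] -/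
@[simp] lemma tameConductorExponent_I_zero : (I 0).tameConductorExponent = 0 := rfl

/-- `ε = 1` for `I_{n+1}`. (Silverman ATAEC IV, §10.) [folklore] -/
@[simp] lemma tameConductorExponent_I_succ (n : ℕ) :
    (I (n + 1)).tameConductorExponent = 1 := rfl

/-- `ε = 2` for `I_n*`. (Silverman ATAEC IV, §10.) [folklore] -/
@[simp] lemma tameConductorExponent_Istar (n : ℕ) : (Istar n).tameConductorExponent = 2 := rfl

/-- `I_n` with `n ≥ 1` has `n` components. (Silverman ATAEC IV, Table 4.1.) [folklore] -/
lemma numComponents_I_of_ne_zero {n : ℕ} (hn : n ≠ 0) : (I n).numComponents = n := by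
  obtain ⟨m, rfl⟩ := Nat.exists_eq_succ_of_ne_zero hn
  rfl

/-- `k` is multiplicative iff `k = I (n + 1)` for some `n`. (Silverman ATAEC IV, Table 4.1.) [folklore] -/
lemma isMultiplicative_iff : k.IsMultiplicative ↔ ∃ n, k = .I (n + 1) := by
  constructor
  · rintro ⟨n, hn, rfl⟩
    obtain ⟨m, rfl⟩ := Nat.exists_eq_succ_of_ne_zero hn
    exact ⟨m, rfl⟩
  · rintro ⟨n, rfl⟩
    exact ⟨n + 1, n.succ_ne_zero, rfl⟩

/-- Good reduction iff the tame conductor exponent vanishes. (Silverman ATAEC IV, §10.) [folklore] -/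
theorem tameConductorExponent_eq_zero_iff : k.tameConductorExponent = 0 ↔ k.IsGood := by
  unfold IsGood
  rcases k with (_ | n) | _ | _ | _ | n | _ | _ | _ <;> simp [tameConductorExponent]

/-- Multiplicative reduction iff the tame conductor exponent is `1`. (Silverman ATAEC IV, §10.) [folklore] -/
theorem tameConductorExponent_eq_one_iff :
    k.tameConductorExponent = 1 ↔ k.IsMultiplicative := by
  rw [isMultiplicative_iff]
  rcases k with (_ | n) | _ | _ | _ | n | _ | _ | _ <;> simp [tameConductorExponent]

/-- Decidability of good reduction (it is an equality in a `DecidableEq` type). [folklore] -/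
instance instDecidableIsGood : Decidable k.IsGood :=
  inferInstanceAs (Decidable (k = .I 0))

/-- Decidability of multiplicative reduction, via `tameConductorExponent_eq_one_iff`. [folklore] -/
instance instDecidableIsMultiplicative : Decidable k.IsMultiplicative :=
  decidable_of_iff _ k.tameConductorExponent_eq_one_iff

/-- Decidability of additive reduction. [folklore] -/
instance instDecidableIsAdditive : Decidable k.IsAdditive :=
  inferInstanceAs (Decidable (¬ k.IsGood ∧ ¬ k.IsMultiplicative))

/-- Decidability of semistable reduction. [folklore] -/
instance instDecidableIsSemistable : Decidable k.IsSemistable :=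
  inferInstanceAs (Decidable (k.IsGood ∨ k.IsMultiplicative))

/-- Every Kodaira type has at least one component. (Silverman ATAEC IV, Table 4.1.) [folklore] -/
theorem numComponents_pos : 0 < k.numComponents := by
  rcases k with (_ | n) | _ | _ | _ | n | _ | _ | _ <;> simp [numComponents]

/-- The component group is nontrivially sized: `0 < |Φ(k̄)|`. (Silverman ATAEC IV, Table 4.1.) [folklore] -/
theorem componentGroupOrder_pos : 0 < k.componentGroupOrder := by
  rcases k with n | _ | _ | _ | n | _ | _ | _ <;> simp [componentGroupOrder]

/-- The tame conductor exponent is at most `2`. (Silverman ATAEC IV, §10.) [folklore] -/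
theorem tameConductorExponent_le_two : k.tameConductorExponent ≤ 2 := by
  rcases k with (_ | n) | _ | _ | _ | n | _ | _ | _ <;> simp [tameConductorExponent]

/-- Trichotomy of reduction types: good, multiplicative or additive.
(Silverman ATAEC IV, Table 4.1; AEC VII.5.) [folklore] -/
theorem isGood_or_isMultiplicative_or_isAdditive :
    k.IsGood ∨ k.IsMultiplicative ∨ k.IsAdditive := by
  unfold IsAdditive
  tauto

/-- Additive reduction iff the tame conductor exponent is `2`. (Silverman ATAEC IV, §10.) [folklore] -/
theorem tameConductorExponent_eq_two_iff : k.tameConductorExponent = 2 ↔ k.IsAdditive := by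
  rw [IsAdditive, ← tameConductorExponent_eq_zero_iff, ← tameConductorExponent_eq_one_iff]
  have := k.tameConductorExponent_le_two
  omega

/-- Semistable reduction iff the tame conductor exponent is at most `1`.
(Silverman ATAEC IV, §10.) [folklore] -/
theorem isSemistable_iff_tameConductorExponent_le_one :
    k.IsSemistable ↔ k.tameConductorExponent ≤ 1 := by
  rw [IsSemistable, ← tameConductorExponent_eq_zero_iff, ← tameConductorExponent_eq_one_iff]
  omega

/-- Semistable iff of type `I_n` for some `n ≥ 0`. (Silverman ATAEC IV, §10.) [folklore] -/
theorem isSemistable_iff_exists_eq_I : k.IsSemistable ↔ ∃ n, k = .I n := by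
  rw [IsSemistable, IsGood, isMultiplicative_iff]
  constructor
  · rintro (rfl | ⟨n, rfl⟩)
    exacts [⟨0, rfl⟩, ⟨n + 1, rfl⟩]
  · rintro ⟨_ | n, rfl⟩
    exacts [Or.inl rfl, Or.inr ⟨n, rfl⟩]

/-! ### The exponent of the component group (cell `bsd-f2-manin`, definition request D1) -/

/-- The EXPONENT of the geometric component group `Φ(k̄) = 𝓔(k̄)/𝓔⁰(k̄)` of the Néron model, by
Kodaira symbol: `I_n ↦ n` (`I₀ ↦ 1`), `II, II* ↦ 1`, `III, III* ↦ 2`, `IV, IV* ↦ 3`, `I_n* ↦ 2` for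
`n` even (`Φ ≅ ℤ/2ℤ × ℤ/2ℤ`) and `I_n* ↦ 4` for `n` odd (`Φ ≅ ℤ/4ℤ`); compare `componentGroupOrder`
(the ORDER, `= 4` for every `I_n*`). Group structures from the Kodaira–Néron table.
[cite: SilvermanAEC2009, App. C §15, Thm. 15.2 and Table 15.1] -/
def componentGroupExponent : KodairaSymbol → ℕ
  | I n => max n 1
  | II => 1
  | III => 2
  | IV => 3
  | Istar n => if Even n then 2 else 4
  | IVstar => 3
  | IIIstar => 2
  | IIstar => 1

/-- `exp Φ = max n 1` for `I_n` (cyclic component group).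
[cite: SilvermanAEC2009, App. C §15, Table 15.1] -/
@[simp] lemma componentGroupExponent_I (n : ℕ) : (I n).componentGroupExponent = max n 1 := rfl

/-- `exp Φ = 2` for `I_n*` with `n` even (`Φ ≅ ℤ/2ℤ × ℤ/2ℤ`).
[cite: SilvermanAEC2009, App. C §15, Table 15.1] -/
@[simp] lemma componentGroupExponent_Istar_of_even {n : ℕ} (h : Even n) :
    (Istar n).componentGroupExponent = 2 := by
  simp [componentGroupExponent, h]

/-- `exp Φ = 4` for `I_n*` with `n` odd (`Φ ≅ ℤ/4ℤ`).
[cite: SilvermanAEC2009, App. C §15, Table 15.1] -/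
@[simp] lemma componentGroupExponent_Istar_of_odd {n : ℕ} (h : Odd n) :
    (Istar n).componentGroupExponent = 4 := by
  simp [componentGroupExponent, Nat.not_even_iff_odd.mpr h]

/-- The exponent of the component group divides its order.
[cite: SilvermanAEC2009, App. C §15, Table 15.1] -/
theorem componentGroupExponent_dvd_componentGroupOrder :
    k.componentGroupExponent ∣ k.componentGroupOrder := by
  rcases k with n | _ | _ | _ | n | _ | _ | _ <;> try simp [componentGroupExponent, componentGroupOrder]
  by_cases h : Even n <;> simp [h]

/-- The exponent of the component group is positive.
[cite: SilvermanAEC2009, App. C §15, Table 15.1] -/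
theorem componentGroupExponent_pos : 0 < k.componentGroupExponent := by
  rcases k with n | _ | _ | _ | n | _ | _ | _ <;> try simp [componentGroupExponent]
  by_cases h : Even n <;> simp [h]

/-- The exponent of the component group is at most its order (hence `≤ 4` in the additive case).
[cite: SilvermanAEC2009, App. C §15, Cor. 15.2.1] -/
theorem componentGroupExponent_le_componentGroupOrder :
    k.componentGroupExponent ≤ k.componentGroupOrder :=
  Nat.le_of_dvd k.componentGroupOrder_pos k.componentGroupExponent_dvd_componentGroupOrder


end KodairaSymbol

end Literature.NumberTheory.DiophantineGeometry
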